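import Mathlib
import Summits.ResolutionOfSingularities.ResolutionOfSingularities.Theorems.WildQuotientsWildQuotientResolutionFixedPointsGraded
import Summits.ResolutionOfSingularities.ResolutionOfSingularities.Theorems.WildQuotientsWildQuotientResolutionLinearSqZero

/-!
# The `D₈`-permutation invariants of `k[X₀,…,X₃]` are the invariants of a bireflection (O12a/O12, chain w45c)

(crux stmt-ResolutionOfSingularities-15640 `WildQuotients.WildQuotientResolution`, post-V5 card O of
`L/res-L1-w45c-idea-2` (Sketch-L1-idea-2.lean v11.1, O12/O12a); [OURS · L1 W4.5c] — NOT a statement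
of any manuscript; classical invariant theory, characteristic-free.)

`D₈ = ⟨ρ = (0 1 2 3), s = (0 2)⟩ ⊂ S₄` permutes the variables of `P = k[X₀,…,X₃]`; `π = (0 1)(2 3)`.
The comparison map `φ : X₀ ↦ X₀ + X₂, X₁ ↦ X₁ + X₃, X₂ ↦ X₀X₂, X₃ ↦ X₁X₃` satisfies `ρ ∘ φ = φ ∘ π`,
`s ∘ φ = φ`; it is injective (`injective_of_apply_X`, from the generic `injective_of_esymm_pair`:
substituting `(u, v) ↦ (u + v, uv)` in two of the variables is injective, by Mathlib's
`MvPolynomial.esymmAlgHom_fin_injective` over the polynomial ring in the remaining variables); and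
its range contains the invariants of the Klein subgroup `K = ⟨(0 2), (1 3)⟩` (`mem_range_of_fixed`:
every `g` is `a + bX₀ + cX₁ + dX₀X₁` with `a, b, c, d ∈ range φ` (`exists_decomp`), and
`(0 2) g = g`, `(1 3) g = g` force `b + dX₁ = 0`, `c = 0`). Hence `φ` restricts to
`P^⟨π⟩ ≃ₐ[k] P^⟨ρ,s⟩` (`dihedralPermInvariantsEquiv` = the body of idea-2's `DihedralPermInvariantsEquiv`
verbatim), and with SQZ-4 (`LinearSqZero.linearInvolution_hasResolution_charTwo`) the wild quotient
`𝔸⁴/D₈` in characteristic `2` has a resolution (`dihedralPerm_hasResolution_charTwo` = the body of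
idea-2's `DihedralPermCharTwoHasResolution` verbatim) — the first non-cyclic wild quotient in the tree.
-/

-- single-problem summit: the doubled namespace component `ResolutionOfSingularities` is forced
set_option linter.dupNamespace false

noncomputable section

open MvPolynomial AlgebraicGeometry CategoryTheory Literature.AlgebraicGeometry.Resolution

namespace Summit.ResolutionOfSingularities.ResolutionOfSingularities.Theorems.WildQuotientResolution.DihedralPerm

/-- Membership in the invariant subalgebra of the group generated by two `k`-algebra automorphisms
`ρ, s`: `u` is invariant iff `ρ u = u` and `s u = u` (the stabilizer of `u` is a subgroup).
[folklore] -/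
theorem mem_fixedPoints_closure_pair_iff {k U : Type*} [Field k] [CommRing U] [Algebra k U]
    (ρ s : U ≃ₐ[k] U) (u : U) :
    u ∈ FixedPoints.subalgebra k U (Subgroup.closure {ρ, s}) ↔ ρ u = u ∧ s u = u := by
  change (∀ g : Subgroup.closure ({ρ, s} : Set (U ≃ₐ[k] U)), g • u = u) ↔ _
  constructor
  · intro h
    exact ⟨h ⟨ρ, Subgroup.subset_closure (by simp)⟩, h ⟨s, Subgroup.subset_closure (by simp)⟩⟩
  · rintro ⟨hρ, hs⟩ g
    have hle : Subgroup.closure ({ρ, s} : Set (U ≃ₐ[k] U)) ≤ MulAction.stabilizer (U ≃ₐ[k] U) u := by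
      rw [Subgroup.closure_le]
      rintro x (rfl | hx)
      · exact MulAction.mem_stabilizer_iff.mpr hρ
      · rw [Set.mem_singleton_iff.mp hx]; exact MulAction.mem_stabilizer_iff.mpr hs
    exact MulAction.mem_stabilizer_iff.mp (hle g.2)

/-- Over any commutative ring `R`, the `R`-algebra endomorphism of `R[u, v]` with `u ↦ u + v`,
`v ↦ uv` is injective: it is Mathlib's `esymmAlgHom (Fin 2) R 2` followed by the inclusion of the
symmetric subalgebra (fundamental theorem of symmetric polynomials, injectivity half). [folklore] -/
theorem injective_of_esymm_two {R : Type*} [CommRing R]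
    (E : MvPolynomial (Fin 2) R →ₐ[R] MvPolynomial (Fin 2) R)
    (h0 : E (X 0) = X 0 + X 1) (h1 : E (X 1) = X 0 * X 1) : Function.Injective E := by
  have hE : E = (symmetricSubalgebra (Fin 2) R).val.comp (esymmAlgHom (Fin 2) R 2) := by
    refine MvPolynomial.algHom_ext fun i => ?_
    rw [AlgHom.comp_apply, Subalgebra.coe_val, esymmAlgHom_apply, aeval_X]
    fin_cases i
    · simpa [esymm_one, Fin.sum_univ_two] using h0
    · have h2 := Finset.powersetCard_self (Finset.univ : Finset (Fin 2))
      rw [Finset.card_univ, Fintype.card_fin] at h2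
      simp only [Fin.mk_one, Fin.isValue]
      rw [h1, show (1 + 1 : ℕ) = 2 from rfl, esymm, h2, Finset.sum_singleton, Fin.prod_univ_two]
  rw [hE, AlgHom.coe_comp]
  exact Subtype.val_injective.comp (esymmAlgHom_fin_injective R le_rfl)

/-- **Injectivity of the pairwise elementary-symmetric substitution.** Let `e : ι ≃ Fin 2 ⊕ τ`
single out two variables `u = X (e⁻¹ (inl 0))`, `v = X (e⁻¹ (inl 1))` of `k[Xᵢ : i ∈ ι]`. A
`k`-algebra endomorphism `ψ` with `ψ u = u + v`, `ψ v = uv` and `ψ` the identity on the remaining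
variables is injective: through `k[Xᵢ] ≅ R[u, v]`, `R = k[X_j : j ∈ τ]` (`sumAlgEquiv`), `ψ` becomes
the `R`-algebra map of `injective_of_esymm_two`. [folklore] -/
theorem injective_of_esymm_pair {k : Type*} [CommRing k] {ι τ : Type*} (e : ι ≃ Fin 2 ⊕ τ)
    (ψ : MvPolynomial ι k →ₐ[k] MvPolynomial ι k)
    (h0 : ψ (X (e.symm (Sum.inl 0))) = X (e.symm (Sum.inl 0)) + X (e.symm (Sum.inl 1)))
    (h1 : ψ (X (e.symm (Sum.inl 1))) = X (e.symm (Sum.inl 0)) * X (e.symm (Sum.inl 1)))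
    (hr : ∀ j, ψ (X (e.symm (Sum.inr j))) = X (e.symm (Sum.inr j))) :
    Function.Injective ψ := by
  -- the structural isomorphism `T : k[Xᵢ] ≃ R[u, v]`, `R = k[X_j : j ∈ τ]`
  let T : MvPolynomial ι k ≃ₐ[k] MvPolynomial (Fin 2) (MvPolynomial τ k) :=
    (renameEquiv k e).trans (sumAlgEquiv k (Fin 2) τ)
  have hTX : ∀ i, T (X i) = sumAlgEquiv k (Fin 2) τ (X (e i)) := by
    intro i
    simp only [T, AlgEquiv.trans_apply, renameEquiv_apply, rename_X]
  have hTl : ∀ a : Fin 2, T (X (e.symm (Sum.inl a))) = X a := by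
    intro a
    rw [hTX, Equiv.apply_symm_apply, sumAlgEquiv_X_inl]
  have hTr : ∀ j : τ, T (X (e.symm (Sum.inr j))) = C (X j) := by
    intro j
    rw [hTX, Equiv.apply_symm_apply, sumAlgEquiv_X_inr]
  -- the `R`-algebra substitution `u ↦ u + v`, `v ↦ uv`
  let E : MvPolynomial (Fin 2) (MvPolynomial τ k) →ₐ[MvPolynomial τ k]
      MvPolynomial (Fin 2) (MvPolynomial τ k) := aeval ![X 0 + X 1, X 0 * X 1]
  have hE0 : E (X 0) = X 0 + X 1 := by simp [E]
  have hE1 : E (X 1) = X 0 * X 1 := by simp [E]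
  have hEinj : Function.Injective E := injective_of_esymm_two E hE0 hE1
  -- `T ∘ ψ = E ∘ T`
  have hcomp : (T : MvPolynomial ι k →ₐ[k] _).comp ψ =
      (E.restrictScalars k).comp (T : MvPolynomial ι k →ₐ[k] _) := by
    refine MvPolynomial.algHom_ext fun i => ?_
    simp only [AlgHom.comp_apply, AlgHom.restrictScalars_apply, AlgEquiv.coe_toAlgHom]
    obtain ⟨x, rfl⟩ := e.symm.surjective i
    rcases x with a | j
    · fin_cases a
      · simp only [Fin.zero_eta, Fin.isValue]
        rw [h0, map_add, hTl, hTl, hE0]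
      · simp only [Fin.mk_one, Fin.isValue]
        rw [h1, map_mul, hTl, hTl, hE1]
    · rw [hr, hTr, aeval_C]
      rfl
  have hfun : ∀ x, T (ψ x) = E (T x) := fun x => by
    simpa using congrArg (fun f => f x) hcomp
  intro x y hxy
  have h := congrArg T hxy
  rw [hfun, hfun] at h
  exact T.injective (hEinj h)

section Phi

variable {k : Type*} [Field k]

/-- The comparison map `φ : X₀ ↦ X₀ + X₂, X₁ ↦ X₁ + X₃, X₂ ↦ X₀X₂, X₃ ↦ X₁X₃` of `k[X₀,…,X₃]` is
injective: it is the composite of the two pairwise elementary-symmetric substitutions in the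
variable pairs `{0, 2}` and `{1, 3}` (`injective_of_esymm_pair` twice). [folklore] -/
theorem injective_of_apply_X (φ : MvPolynomial (Fin 4) k →ₐ[k] MvPolynomial (Fin 4) k)
    (hφ0 : φ (X 0) = X 0 + X 2) (hφ1 : φ (X 1) = X 1 + X 3) (hφ2 : φ (X 2) = X 0 * X 2)
    (hφ3 : φ (X 3) = X 1 * X 3) : Function.Injective φ := by
  -- the two partial substitutions
  let ψ : MvPolynomial (Fin 4) k →ₐ[k] MvPolynomial (Fin 4) k :=
    aeval ![X 0 + X 2, X 1, X 0 * X 2, X 3]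
  let ψ' : MvPolynomial (Fin 4) k →ₐ[k] MvPolynomial (Fin 4) k :=
    aeval ![X 0, X 1 + X 3, X 2, X 1 * X 3]
  have hφ : φ = ψ'.comp ψ := by
    refine MvPolynomial.algHom_ext fun i => ?_
    fin_cases i <;> simp [ψ, ψ', hφ0, hφ1, hφ2, hφ3]
  -- the two splittings `Fin 4 ≃ Fin 2 ⊕ Fin 2`
  obtain ⟨e, he0, he1, he2, he3⟩ : ∃ e : Fin 4 ≃ Fin 2 ⊕ Fin 2,
      e.symm (Sum.inl 0) = 0 ∧ e.symm (Sum.inl 1) = 2 ∧ e.symm (Sum.inr 0) = 1 ∧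
        e.symm (Sum.inr 1) = 3 :=
    ⟨⟨![Sum.inl 0, Sum.inr 0, Sum.inl 1, Sum.inr 1], Sum.elim ![0, 2] ![1, 3], by decide, by decide⟩,
      rfl, rfl, rfl, rfl⟩
  obtain ⟨e', he0', he1', he2', he3'⟩ : ∃ e' : Fin 4 ≃ Fin 2 ⊕ Fin 2,
      e'.symm (Sum.inl 0) = 1 ∧ e'.symm (Sum.inl 1) = 3 ∧ e'.symm (Sum.inr 0) = 0 ∧
        e'.symm (Sum.inr 1) = 2 :=
    ⟨⟨![Sum.inr 0, Sum.inl 0, Sum.inr 1, Sum.inl 1], Sum.elim ![1, 3] ![0, 2], by decide, by decide⟩,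
      rfl, rfl, rfl, rfl⟩
  have hψ : Function.Injective ψ := by
    refine injective_of_esymm_pair e ψ ?_ ?_ ?_
    · rw [he0, he1]; simp [ψ]
    · rw [he0, he1]; simp [ψ]
    · intro j; fin_cases j
      · simp only [Fin.zero_eta, Fin.isValue]; rw [he2]; simp [ψ]
      · simp only [Fin.mk_one, Fin.isValue]; rw [he3]; simp [ψ]
  have hψ' : Function.Injective ψ' := by
    refine injective_of_esymm_pair e' ψ' ?_ ?_ ?_
    · rw [he0', he1']; simp [ψ']
    · rw [he0', he1']; simp [ψ']
    · intro j; fin_cases j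
      · simp only [Fin.zero_eta, Fin.isValue]; rw [he2']; simp [ψ']
      · simp only [Fin.mk_one, Fin.isValue]; rw [he3']; simp [ψ']
  rw [hφ, AlgHom.coe_comp]
  exact hψ'.comp hψ

/-- Every `g ∈ k[X₀,…,X₃]` is `a + bX₀ + cX₁ + dX₀X₁` with `a, b, c, d` in the range of the comparison
map `φ` (i.e. in `k[X₀ + X₂, X₁ + X₃, X₀X₂, X₁X₃]`): the set of such elements contains the constants
and is stable under multiplication by each variable (`X₀² = (X₀ + X₂)X₀ − X₀X₂`, `X₂ = (X₀ + X₂) − X₀`,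
and symmetrically for `X₁, X₃`). [folklore] -/
theorem exists_decomp (φ : MvPolynomial (Fin 4) k →ₐ[k] MvPolynomial (Fin 4) k)
    (hφ0 : φ (X 0) = X 0 + X 2) (hφ1 : φ (X 1) = X 1 + X 3) (hφ2 : φ (X 2) = X 0 * X 2)
    (hφ3 : φ (X 3) = X 1 * X 3) (g : MvPolynomial (Fin 4) k) :
    ∃ a ∈ φ.range, ∃ b ∈ φ.range, ∃ c ∈ φ.range, ∃ d ∈ φ.range,
      g = a + b * X 0 + c * X 1 + d * (X 0 * X 1) := by
  have he₁ : (X 0 + X 2 : MvPolynomial (Fin 4) k) ∈ φ.range := ⟨X 0, hφ0⟩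
  have hf₁ : (X 1 + X 3 : MvPolynomial (Fin 4) k) ∈ φ.range := ⟨X 1, hφ1⟩
  have he₂ : (X 0 * X 2 : MvPolynomial (Fin 4) k) ∈ φ.range := ⟨X 2, hφ2⟩
  have hf₂ : (X 1 * X 3 : MvPolynomial (Fin 4) k) ∈ φ.range := ⟨X 3, hφ3⟩
  induction g using MvPolynomial.induction_on with
  | C r =>
    exact ⟨C r, by rw [← MvPolynomial.algebraMap_eq]; exact φ.range.algebraMap_mem r,
      0, φ.range.zero_mem, 0, φ.range.zero_mem, 0, φ.range.zero_mem, by ring⟩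
  | add p q hp hq =>
    obtain ⟨a, ha, b, hb, c, hc, d, hd, rfl⟩ := hp
    obtain ⟨a', ha', b', hb', c', hc', d', hd', rfl⟩ := hq
    exact ⟨a + a', φ.range.add_mem ha ha', b + b', φ.range.add_mem hb hb', c + c',
      φ.range.add_mem hc hc', d + d', φ.range.add_mem hd hd', by ring⟩
  | mul_X p i hp =>
    obtain ⟨a, ha, b, hb, c, hc, d, hd, rfl⟩ := hp
    fin_cases i
    · -- `X₀`: `X₀² = e₁ X₀ − e₂`
      refine ⟨-(b * (X 0 * X 2)), φ.range.neg_mem (φ.range.mul_mem hb he₂),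
        a + b * (X 0 + X 2), φ.range.add_mem ha (φ.range.mul_mem hb he₁),
        -(d * (X 0 * X 2)), φ.range.neg_mem (φ.range.mul_mem hd he₂),
        c + d * (X 0 + X 2), φ.range.add_mem hc (φ.range.mul_mem hd he₁), ?_⟩
      simp only [Fin.zero_eta, Fin.isValue]
      ring
    · -- `X₁`: `X₁² = f₁ X₁ − f₂`
      refine ⟨-(c * (X 1 * X 3)), φ.range.neg_mem (φ.range.mul_mem hc hf₂),
        -(d * (X 1 * X 3)), φ.range.neg_mem (φ.range.mul_mem hd hf₂),
        a + c * (X 1 + X 3), φ.range.add_mem ha (φ.range.mul_mem hc hf₁),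
        b + d * (X 1 + X 3), φ.range.add_mem hb (φ.range.mul_mem hd hf₁), ?_⟩
      simp only [Fin.mk_one, Fin.isValue]
      ring
    · -- `X₂ = e₁ − X₀`, `X₀X₂ = e₂`
      refine ⟨a * (X 0 + X 2) + b * (X 0 * X 2),
        φ.range.add_mem (φ.range.mul_mem ha he₁) (φ.range.mul_mem hb he₂),
        -a, φ.range.neg_mem ha,
        c * (X 0 + X 2) + d * (X 0 * X 2),
        φ.range.add_mem (φ.range.mul_mem hc he₁) (φ.range.mul_mem hd he₂),
        -c, φ.range.neg_mem hc, ?_⟩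
      simp only [Fin.reduceFinMk, Fin.isValue]
      ring
    · -- `X₃ = f₁ − X₁`, `X₁X₃ = f₂`
      refine ⟨a * (X 1 + X 3) + c * (X 1 * X 3),
        φ.range.add_mem (φ.range.mul_mem ha hf₁) (φ.range.mul_mem hc hf₂),
        b * (X 1 + X 3) + d * (X 1 * X 3),
        φ.range.add_mem (φ.range.mul_mem hb hf₁) (φ.range.mul_mem hd hf₂),
        -a, φ.range.neg_mem ha, -b, φ.range.neg_mem hb, ?_⟩
      simp only [Fin.reduceFinMk, Fin.isValue]
      ring

/-- **Klein-four invariants lie in `k[X₀ + X₂, X₁ + X₃, X₀X₂, X₁X₃]`.** If `g ∈ k[X₀,…,X₃]` is fixed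
by a `k`-algebra map `s` with `s X₀ = X₂`, `s X₁ = X₁` and by a `k`-algebra map `t` with `t X₁ = X₃`,
both acting trivially on the range of the comparison map `φ`, then `g ∈ range φ`: writing
`g = a + bX₀ + cX₁ + dX₀X₁` (`exists_decomp`), `g = s g` gives `(b + dX₁)(X₀ − X₂) = 0`, so
`g = a + cX₁`, and `g = t g` gives `c (X₁ − X₃) = 0`. [folklore] -/
theorem mem_range_of_fixed (φ : MvPolynomial (Fin 4) k →ₐ[k] MvPolynomial (Fin 4) k)
    (hφ0 : φ (X 0) = X 0 + X 2) (hφ1 : φ (X 1) = X 1 + X 3) (hφ2 : φ (X 2) = X 0 * X 2)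
    (hφ3 : φ (X 3) = X 1 * X 3)
    (s t : MvPolynomial (Fin 4) k →ₐ[k] MvPolynomial (Fin 4) k)
    (hs0 : s (X 0) = X 2) (hs1 : s (X 1) = X 1) (ht1 : t (X 1) = X 3)
    (hsφ : ∀ a ∈ φ.range, s a = a) (htφ : ∀ a ∈ φ.range, t a = a)
    {g : MvPolynomial (Fin 4) k} (hsg : s g = g) (htg : t g = g) : g ∈ φ.range := by
  obtain ⟨a, ha, b, hb, c, hc, d, hd, rfl⟩ := exists_decomp φ hφ0 hφ1 hφ2 hφ3 g
  have hX02 : (X 0 - X 2 : MvPolynomial (Fin 4) k) ≠ 0 :=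
    sub_ne_zero.mpr fun h => absurd (MvPolynomial.X_injective h) (by decide)
  have hX31 : (X 3 - X 1 : MvPolynomial (Fin 4) k) ≠ 0 :=
    sub_ne_zero.mpr fun h => absurd (MvPolynomial.X_injective h) (by decide)
  -- `s g = a + b X₂ + c X₁ + d X₂ X₁`
  have hsg' : s (a + b * X 0 + c * X 1 + d * (X 0 * X 1)) = a + b * X 2 + c * X 1 + d * (X 2 * X 1) := by
    simp only [map_add, map_mul, hsφ a ha, hsφ b hb, hsφ c hc, hsφ d hd, hs0, hs1]
  have hbd : (b + d * X 1) * (X 0 - X 2) = 0 := by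
    have h := hsg
    rw [hsg'] at h
    linear_combination -h
  have hbd' : b + d * X 1 = 0 := (mul_eq_zero.mp hbd).resolve_right hX02
  have hg : a + b * X 0 + c * X 1 + d * (X 0 * X 1) = a + c * X 1 := by
    linear_combination (X 0) * hbd'
  rw [hg] at htg ⊢
  -- `t g = a + c X₃`
  have htg' : t (a + c * X 1) = a + c * X 3 := by
    simp only [map_add, map_mul, htφ a ha, htφ c hc, ht1]
  have hc0 : c * (X 3 - X 1) = 0 := by
    rw [htg'] at htg
    linear_combination htg
  have hc0' : c = 0 := (mul_eq_zero.mp hc0).resolve_right hX31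
  rw [hc0', zero_mul, add_zero]
  exact ha

end Phi

/-- Two `k`-algebra maps out of `k[X₀,…,X₃]` agree as soon as they agree on the four variables
(restatement of `MvPolynomial.algHom_ext` in pointwise form). [folklore] -/
theorem algHom_apply_eq_of_apply_X {k : Type*} [CommSemiring k] {A : Type*} [Semiring A] [Algebra k A]
    (f g : MvPolynomial (Fin 4) k →ₐ[k] A) (h : ∀ i, f (X i) = g (X i)) (x : MvPolynomial (Fin 4) k) :
    f x = g x := by
  rw [MvPolynomial.algHom_ext h]

/-- **O12a** [OURS · L1 W4.5c · card O of `res-L1-w45c-idea-2`] — the body of idea-2's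
`DihedralPermInvariantsEquiv` verbatim. For the permutation action of
`D₈ = ⟨ρ = (0 1 2 3), s = (0 2)⟩ ⊂ S₄` on `k[X₀,…,X₃]` and the coordinate involution
`π = (0 1)(2 3)`, the invariant rings are isomorphic as `k`-algebras:
`k[X]^⟨ρ, s⟩ ≃ₐ[k] k[X]^⟨π⟩`. The isomorphism is induced by the comparison map
`φ : X₀ ↦ X₀ + X₂, X₁ ↦ X₁ + X₃, X₂ ↦ X₀X₂, X₃ ↦ X₁X₃`: `ρ ∘ φ = φ ∘ π`, `s ∘ φ = φ`, `φ` is injective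
(`injective_of_apply_X`) and its range is the ring of invariants of the Klein subgroup
`⟨(0 2), (1 3) = ρ s ρ⁻¹⟩` (`mem_range_of_fixed`), on which `D₈` acts through `ρ`, i.e. through `π`.
(The hypothesis `CharP k 2` is part of the registered statement and is not used.) [folklore] -/
theorem dihedralPermInvariantsEquiv :
    ∀ (k : Type) [Field k] [CharP k 2]
    (ρ s π : MvPolynomial (Fin 4) k ≃ₐ[k] MvPolynomial (Fin 4) k),
    ρ (X 0) = X 1 → ρ (X 1) = X 2 → ρ (X 2) = X 3 → ρ (X 3) = X 0 →
    s (X 0) = X 2 → s (X 1) = X 1 → s (X 2) = X 0 → s (X 3) = X 3 →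
    π (X 0) = X 1 → π (X 1) = X 0 → π (X 2) = X 3 → π (X 3) = X 2 →
      Nonempty (↥(FixedPoints.subalgebra k (MvPolynomial (Fin 4) k) (Subgroup.closure {ρ, s})) ≃ₐ[k]
                ↥(FixedPoints.subalgebra k (MvPolynomial (Fin 4) k) (Subgroup.zpowers π))) := by
  intro k _ _ ρ s π hρ0 hρ1 hρ2 hρ3 hs0 hs1 hs2 hs3 hπ0 hπ1 hπ2 hπ3
  -- the comparison map
  let φ : MvPolynomial (Fin 4) k →ₐ[k] MvPolynomial (Fin 4) k :=
    aeval ![X 0 + X 2, X 1 + X 3, X 0 * X 2, X 1 * X 3]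
  have hφ0 : φ (X 0) = X 0 + X 2 := by simp [φ]
  have hφ1 : φ (X 1) = X 1 + X 3 := by simp [φ]
  have hφ2 : φ (X 2) = X 0 * X 2 := by simp [φ]
  have hφ3 : φ (X 3) = X 1 * X 3 := by simp [φ]
  -- values of `ρ⁻¹`
  have hρ'0 : ρ.symm (X 0) = X 3 := by rw [AlgEquiv.symm_apply_eq, hρ3]
  have hρ'1 : ρ.symm (X 1) = X 0 := by rw [AlgEquiv.symm_apply_eq, hρ0]
  have hρ'2 : ρ.symm (X 2) = X 1 := by rw [AlgEquiv.symm_apply_eq, hρ1]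
  have hρ'3 : ρ.symm (X 3) = X 2 := by rw [AlgEquiv.symm_apply_eq, hρ2]
  -- the transposition `t = ρ s ρ⁻¹ = (1 3)`
  let t : MvPolynomial (Fin 4) k ≃ₐ[k] MvPolynomial (Fin 4) k := ρ.symm.trans (s.trans ρ)
  have ht : ∀ x, t x = ρ (s (ρ.symm x)) := fun x => rfl
  have ht0 : t (X 0) = X 0 := by rw [ht, hρ'0, hs3, hρ3]
  have ht1 : t (X 1) = X 3 := by rw [ht, hρ'1, hs0, hρ2]
  have ht2 : t (X 2) = X 2 := by rw [ht, hρ'2, hs1, hρ1]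
  have ht3 : t (X 3) = X 1 := by rw [ht, hρ'3, hs2, hρ0]
  -- intertwining relations on the range of `φ`
  have hρφ : ∀ x, ρ (φ x) = φ (π x) := by
    intro x
    refine algHom_apply_eq_of_apply_X ((ρ : _ →ₐ[k] _).comp φ) (φ.comp (π : _ →ₐ[k] _)) ?_ x
    intro i
    fin_cases i <;>
      simp [AlgHom.comp_apply, hφ0, hφ1, hφ2, hφ3, hπ0, hπ1, hπ2, hπ3, hρ0, hρ1, hρ2, hρ3,
        map_add, map_mul] <;> ring
  have hsφ : ∀ x, s (φ x) = φ x := by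
    intro x
    refine algHom_apply_eq_of_apply_X ((s : _ →ₐ[k] _).comp φ) φ ?_ x
    intro i
    fin_cases i <;>
      simp [AlgHom.comp_apply, hφ0, hφ1, hφ2, hφ3, hs0, hs1, hs2, hs3, map_add, map_mul] <;> ring
  have htφ : ∀ x, t (φ x) = φ x := by
    intro x
    refine algHom_apply_eq_of_apply_X ((t : _ →ₐ[k] _).comp φ) φ ?_ x
    intro i
    fin_cases i <;>
      simp [AlgHom.comp_apply, hφ0, hφ1, hφ2, hφ3, ht0, ht1, ht2, ht3, map_add, map_mul] <;> ring
  have hinj : Function.Injective φ := injective_of_apply_X φ hφ0 hφ1 hφ2 hφ3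
  -- `φ` restricted to the `π`-invariants, with values in the `⟨ρ, s⟩`-invariants
  let Fπ := FixedPoints.subalgebra k (MvPolynomial (Fin 4) k) (Subgroup.zpowers π)
  let FD := FixedPoints.subalgebra k (MvPolynomial (Fin 4) k) (Subgroup.closure {ρ, s})
  have hmemD : ∀ f : Fπ, φ (f : MvPolynomial (Fin 4) k) ∈ FD := by
    intro f
    have hf : π (f : MvPolynomial (Fin 4) k) = f :=
      (TameTransfer.mem_fixedPoints_zpowers_iff_apply_eq π _).mp f.2
    rw [mem_fixedPoints_closure_pair_iff]
    exact ⟨by rw [hρφ, hf], hsφ _⟩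
  let ψ : Fπ →ₐ[k] FD := (φ.comp Fπ.val).codRestrict FD hmemD
  have hψinj : Function.Injective ψ := by
    intro f g hfg
    have h : φ (f : MvPolynomial (Fin 4) k) = φ g := congrArg Subtype.val hfg
    exact Subtype.ext (hinj h)
  have hψsurj : Function.Surjective ψ := by
    intro g
    have hg := (mem_fixedPoints_closure_pair_iff ρ s (g : MvPolynomial (Fin 4) k)).mp g.2
    have htg : t (g : MvPolynomial (Fin 4) k) = g := by
      rw [ht, (AlgEquiv.symm_apply_eq ρ).mpr hg.1.symm, hg.2, hg.1]
    have hmem : (g : MvPolynomial (Fin 4) k) ∈ φ.range :=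
      mem_range_of_fixed φ hφ0 hφ1 hφ2 hφ3 (s : _ →ₐ[k] _) (t : _ →ₐ[k] _) hs0 hs1 ht1
        (fun a ha => by obtain ⟨x, rfl⟩ := ha; exact hsφ x)
        (fun a ha => by obtain ⟨x, rfl⟩ := ha; exact htφ x) hg.2 htg
    obtain ⟨f, hf⟩ := hmem
    have hf' : φ f = g := hf
    have hfπ : f ∈ Fπ := by
      rw [TameTransfer.mem_fixedPoints_zpowers_iff_apply_eq]
      apply hinj
      rw [← hρφ, hf', hg.1]
    exact ⟨⟨f, hfπ⟩, Subtype.ext hf'⟩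
  exact ⟨(AlgEquiv.ofBijective ψ ⟨hψinj, hψsurj⟩).symm⟩

/-- **O12** [OURS · L1 W4.5c · card O of `res-L1-w45c-idea-2`] — the body of idea-2's
`DihedralPermCharTwoHasResolution` verbatim. The wild quotient `𝔸⁴/D₈` of the permutation
representation of `D₈ = ⟨(0 1 2 3), (0 2)⟩ ⊂ S₄` over a field of characteristic `2` has a
resolution of singularities: by `dihedralPermInvariantsEquiv` its coordinate ring is isomorphic to
the invariant ring of the coordinate bireflection `π = (0 1)(2 3)` (a linear involution), whose
spectrum is resolved by SQZ-4 `LinearSqZero.linearInvolution_hasResolution_charTwo`; transport along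
`Spec` of the ring isomorphism (`Scheme.HasResolution.of_iso`). This is idea-2's proved glue
`dihedralPermCharTwoHasResolution_of` with the stub O12a discharged.
[cite: KiralyLutkebohmert2013, Thm 2] -/
theorem dihedralPerm_hasResolution_charTwo :
    ∀ (k : Type) [Field k] [CharP k 2]
    (ρ s : MvPolynomial (Fin 4) k ≃ₐ[k] MvPolynomial (Fin 4) k),
    ρ (X 0) = X 1 → ρ (X 1) = X 2 → ρ (X 2) = X 3 → ρ (X 3) = X 0 →
    s (X 0) = X 2 → s (X 1) = X 1 → s (X 2) = X 0 → s (X 3) = X 3 →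
      Scheme.HasResolution
        (Spec (.of (FixedPoints.subalgebra k (MvPolynomial (Fin 4) k) (Subgroup.closure {ρ, s})))) := by
  intro k _ _ ρ s hρ0 hρ1 hρ2 hρ3 hs0 hs1 hs2 hs3
  -- the coordinate involution `π = (0 1)(2 3)`
  let σ : Equiv.Perm (Fin 4) := Equiv.swap 0 1 * Equiv.swap 2 3
  let π : MvPolynomial (Fin 4) k ≃ₐ[k] MvPolynomial (Fin 4) k := renameEquiv k σ
  have hπ : ∀ i, π (X i) = X (σ i) := fun i => by simp [π, renameEquiv_apply, rename_X]
  have hπ0 : π (X 0) = X 1 := by rw [hπ]; rfl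
  have hπ1 : π (X 1) = X 0 := by rw [hπ]; rfl
  have hπ2 : π (X 2) = X 3 := by rw [hπ]; rfl
  have hπ3 : π (X 3) = X 2 := by rw [hπ]; rfl
  obtain ⟨e⟩ := dihedralPermInvariantsEquiv k ρ s π hρ0 hρ1 hρ2 hρ3 hs0 hs1 hs2 hs3 hπ0 hπ1 hπ2 hπ3
  have hlin : ∀ i, π (X i) ∈ Submodule.span k (Set.range (X : Fin 4 → MvPolynomial (Fin 4) k)) :=
    fun i => by rw [hπ]; exact Submodule.subset_span ⟨σ i, rfl⟩
  have hinv : ∀ i, π (π (X i)) = X i := fun i => by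
    rw [hπ, hπ]; fin_cases i <;> rfl
  have h := LinearSqZero.linearInvolution_hasResolution_charTwo k 4 π hlin hinv
  let ι : CommRingCat.of ↥(FixedPoints.subalgebra k (MvPolynomial (Fin 4) k) (Subgroup.closure {ρ, s})) ≅
      CommRingCat.of ↥(FixedPoints.subalgebra k (MvPolynomial (Fin 4) k) (Subgroup.zpowers π)) :=
    e.toRingEquiv.toCommRingCatIso
  exact Scheme.HasResolution.of_iso (Spec.map ι.hom) h

end Summit.ResolutionOfSingularities.ResolutionOfSingularities.Theorems.WildQuotientResolution.DihedralPerm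

end
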